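import Summits.AtomisticToContinuum.Crystallization.Theorems.FrustratedLawDichotomyStrainedPatchGaugeCells
import Summits.AtomisticToContinuum.Crystallization.Theorems.FrustratedLawDichotomyStrainedPatchHomLatticeBoxHcp
import Summits.AtomisticToContinuum.Crystallization.Theorems.FrustratedLawDichotomyStrainedPatchTaylorLattice

/-!
(SPLIT FOR THE 400-LINE CAP by the landing lane, hand-2 g30: this file = part 1 of 2; sequels `…FrustratedLawDichotomyStrainedPatchIndexNets` import it in a chain; same namespace, all FQNs unchanged.)
# INDEX NETS: the census's data-level instantiation of the abstract riding net `(φ, R, c, P)` of «FrameCells» §2b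
# (27623 T-side line of record, critic row 1113 (iii); lens-5 g65 addendum = g66 item (a) delivered early)

The cover piece of record (FrameCells rev 3, `tubeP_of_frameNet_WSym`) is stated over an ABSTRACT net: branches `φ : Fin K → Bool`, references
`R : (k : Fin K) → (E3 →L[ℝ] E3) → E3 → Fin (Mk k) → E3`, centres `c`, boxes `P`, with the hypothesis `NetGood φ R c P` = per box: the listing is
INJECTIVE (rev 3; rev 2's `7/10`-separation was unsatisfiable on window-covering nets — `exists_wSym_latSet_norm_lt`), centred, of norm `≤ 14`,
lattice-valued and complete below norm `10`.  This module gives the census's concrete instance and reduces those five clauses to DATA-LEVEL conditions: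

* §1 `symVec φ G ξ n s = G (nomVec φ n s + offOf φ s ξ)` — the lattice vector with integer index `n` and sublattice bit `s` (62B's HOME-only `latVec`,
  re-typed over the tree); `symVec_mem`, `exists_symVec_of_mem` (every lattice vector is symbolic), norm bounds on an operator ball
  `‖G − U₀‖ ≤ r` inside the quarter window (`norm_symVec_le/ge`), and ★ `symVec_injective_idx` — distinct admissible index data give distinct vectors
  whenever `‖G − 1‖ ≤ 1/4`, `‖ξ‖ ≤ 1/4` (tree: `latPt_fcc_injective`, `latPt_hex_injective`, `shifted_ne_unshifted`; `norm_apply_le_of_near_one` of `…TaylorLattice`).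
* §2 `IdxNet K` (branch, site count, index, bit, centre per reference — 62B's `SymNet` without the nominal matrix), `N.ref`, the operator-ball boxes
  `ballBox U₀ r Ξ k G ξ := ‖G − U₀ k‖ ≤ r k ∧ ‖G − 1‖ ≤ 1/4 ∧ ‖ξ‖ ≤ 1/4 ∧ ξ ∈ Ξ k`, and the DATA-LEVEL goodness `N.GoodData k U₀ r`: bits admissible,
  index data pairwise distinct, centre = index `0`/bit `false` (all DECIDABLE on the census's integer data), plus two real inequalities per index —
  `‖U₀ w‖ + r‖w‖ + 5/16 ≤ 14` for listed nominal vectors `w` and `10 + 5/16 + r‖w‖ < ‖U₀ w‖` for unlisted ones (rational `U₀`, `r`; `‖w‖²` rational up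
  to the frame's surds — interval-checkable), the unlisted family being FINITE by `far_index_ok` (indices of nominal norm `> (165/16)/(1 − ‖U₀ − 1‖ − r)` are
  automatic).
* §3 ★★ `netGood_clauses_of_goodData` — `(∀ k, N.GoodData k (U₀ k) (r k)) →` the five `NetGood` clauses for `(N.φ, N.ref, N.c, ballBox U₀ r Ξ)`, stated
  UNFOLDED (this module does not import the HOME-only FrameCells file; once it lands, `netGood_idxNet : … → NetGood N.φ N.ref N.c (ballBox U₀ r Ξ)` is this
  theorem verbatim), and `boxesCoverW_clauses_of_ballCover` — the window cover `BoxesCoverW N.φ (ballBox U₀ r Ξ) WSym` (unfolded) from a cover of the symmetric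
  quarter window by the balls and of the offset ball by the cells `Ξ` [ELEMENTARY · finite-dimensional; the census's U-tree / ξ-leaf architecture].

V2 (satisfiability of the structural hypotheses, critic row 1109): `GoodData` is satisfiable box by box by construction — take `r ≤ 1/10`, list exactly the
admissible index data `(n, s)` with `‖U₀ (nomVec φ n s)‖ ≤ 12` (then listed: `≤ 12 + 16 r + 5/16 ≤ 14`; unlisted: `‖U₀ w‖ > 12 ≥ 10 + 5/16 + r‖w‖` as long as
`‖w‖ ≤ 16`, and beyond that `far_index_ok`), centre `(0, false)`; the instance is census DATA (≈ 6·10³ indices per box), checked there, not typed here.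
Every piece is strictly weaker than anything energetic: no potential, no (TF), no `TubeP` occurs in this module (it is lattice bookkeeping).
-/

noncomputable section

namespace Summit.AtomisticToContinuum.Crystallization.Theorems.FrustratedLawDichotomyStrainedPatchIndexNets

open scoped BigOperators Classical RealInnerProductSpace
open Literature.Geometry.DiscreteGeometry (fccKissingPattern hcpKissingPattern card_fccKissingPattern card_hcpKissingPattern
  norm_eq_one_of_mem_fccKissingPattern norm_eq_one_of_mem_hcpKissingPattern one_le_dist_of_mem_fccKissingPattern one_le_dist_of_mem_hcpKissingPattern)
open Summit.AtomisticToContinuum.Crystallization.Theorems.FrustratedLawDichotomyPeriodicBlockFlags (goodAtScale_mono)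
open Summit.AtomisticToContinuum.Crystallization.Theorems.FrustratedLawDichotomyRangeCut (Sep)
open Summit.AtomisticToContinuum.Crystallization.Theorems.FrustratedLawDichotomyMotifLemmas
open Summit.AtomisticToContinuum.Crystallization.Theorems.FrustratedLawDichotomyAveragingCut
open Summit.AtomisticToContinuum.Crystallization.Theorems.FrustratedLawDichotomyAveragingRuleCap
open Summit.AtomisticToContinuum.Crystallization.Theorems.FrustratedLawDichotomyAveragingRuleTightFree
open Summit.AtomisticToContinuum.Crystallization.Theorems.FrustratedLawDichotomyExemptDoor (SitePred)
open Summit.AtomisticToContinuum.Crystallization.Theorems.FrustratedLawDichotomyExemptAbsorption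
open Summit.AtomisticToContinuum.Crystallization.Theorems.FrustratedLawDichotomyExemptAbsorptionRecord
open Summit.AtomisticToContinuum.Crystallization.Theorems.FrustratedLawDichotomyCollarCensus
open Summit.AtomisticToContinuum.Crystallization.Theorems.FrustratedLawDichotomyCollarCensusKappa
open Summit.AtomisticToContinuum.Crystallization.Theorems.FrustratedLawDichotomyStrainedPatchHomSplit
open Summit.AtomisticToContinuum.Crystallization.Theorems.FrustratedLawDichotomyStrainedPatchCleanCollar
open Summit.AtomisticToContinuum.Crystallization.Theorems.FrustratedLawDichotomyStrainedPatchHomTube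
open Summit.AtomisticToContinuum.Crystallization.Theorems.FrustratedLawDichotomyStrainedPatchHomPolar
open Summit.AtomisticToContinuum.Crystallization.Theorems.FrustratedLawDichotomyStrainedPatchHomIsometry
open Summit.AtomisticToContinuum.Crystallization.Theorems.FrustratedLawDichotomyStrainedPatchHomTubeIso
open Summit.AtomisticToContinuum.Crystallization.Theorems.FrustratedLawDichotomyStrainedPatchPhaseCut
open Summit.AtomisticToContinuum.Crystallization.Theorems.FrustratedLawDichotomyStrainedPatchCoreTube
open Summit.AtomisticToContinuum.Crystallization.Theorems.FrustratedLawDichotomyStrainedPatchCoreTubeRecord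
open Summit.AtomisticToContinuum.Crystallization.Theorems.FrustratedLawDichotomyStrainedPatchCoreTubeMilli
open Summit.AtomisticToContinuum.Crystallization.Theorems.FrustratedLawDichotomyStrainedPatchStrainBands
open Summit.AtomisticToContinuum.Crystallization.Theorems.FrustratedLawDichotomyStrainedPatchChartFamilies
open Summit.AtomisticToContinuum.Crystallization.Theorems.FrustratedLawDichotomyStrainedPatchChartFamiliesBent
open Summit.AtomisticToContinuum.Crystallization.Theorems.FrustratedLawDichotomyStrainedPatchChartFamiliesPinned
open Summit.AtomisticToContinuum.Crystallization.Theorems.FrustratedLawDichotomyStrainedPatchRecutPairs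
open Summit.AtomisticToContinuum.Crystallization.Theorems.FrustratedLawDichotomyStrainedPatchRecutKinematics
open Summit.AtomisticToContinuum.Crystallization.Theorems.FrustratedLawDichotomyStrainedPatchWindowFamilies
open Summit.AtomisticToContinuum.Crystallization.Theorems.FrustratedLawDichotomyStrainedPatchHostCells
open Summit.AtomisticToContinuum.Crystallization.Theorems.FrustratedLawDichotomyStrainedPatchGaugeCells
open Summit.AtomisticToContinuum.Crystallization.Theorems.FrustratedLawDichotomyStrainedPatchHomLatticeBox
open Summit.AtomisticToContinuum.Crystallization.Theorems.FrustratedLawDichotomyStrainedPatchHomLatticeBoxHcp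
open Literature.Barriers.AtomisticToContinuum.FlatleyTheil2015 (fccVec fccPoint norm_fccPoint_sq)
open Summit.AtomisticToContinuum.Crystallization.Theorems.FrustratedLawDichotomyStrainedPatchHomRelief (latPt_fccVec_eq)
open Summit.AtomisticToContinuum.Crystallization.Theorems.FrustratedLawDichotomyStrainedPatchTaylorLattice (norm_apply_le_of_near_one)

/-! ## §1. Symbolic lattice vectors -/

section Sym
variable {φ s s' : Bool} {G U₀ : E3 →L[ℝ] E3} {ξ v : E3} {n n' : Fin 3 → ℤ} {r : ℝ}

/-- The NOMINAL (parameter-free) vector of index `n`, bit `s` on branch `φ`: fcc `Σ nᵢ fccVecᵢ` (bit ignored); hcp A-site `Σ nᵢ hexFrameᵢ` (`s = false`),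
hcp B-site `Σ nᵢ hexFrameᵢ + hcpShift` (`s = true`). -/
def nomVec (φ : Bool) (n : Fin 3 → ℤ) (s : Bool) : E3 :=
  cond φ (latPt 1 fccVec n) (cond s (latPt 1 hexFrame n + hcpShift) (latPt 1 hexFrame n))

/-- The offset part: `ξ` on hcp B-sites, `0` otherwise. -/
def offOf (φ s : Bool) (ξ : E3) : E3 := cond φ 0 (cond s ξ 0)

/-- **`symVec φ G ξ n s := G (nomVec φ n s + offOf φ s ξ)`** — the lattice vector with index `n`, bit `s` of the branch-`φ` lattice `(G, ξ)` (62B `latVec`). -/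
def symVec (φ : Bool) (G : E3 →L[ℝ] E3) (ξ : E3) (n : Fin 3 → ℤ) (s : Bool) : E3 := G (nomVec φ n s + offOf φ s ξ)

/-- `symVec_true` (docstring added by the landing lane; see the module docstring). [formal bookkeeping] -/
theorem symVec_true (G : E3 →L[ℝ] E3) (ξ : E3) (n : Fin 3 → ℤ) (s : Bool) : symVec true G ξ n s = latPt G fccVec n := by
  simp only [symVec, nomVec, offOf, cond_true, add_zero, ← latPt_eq_apply_one]

/-- `symVec_false_false` (docstring added by the landing lane; see the module docstring). [formal bookkeeping] -/
theorem symVec_false_false (G : E3 →L[ℝ] E3) (ξ : E3) (n : Fin 3 → ℤ) : symVec false G ξ n false = latPt G hexFrame n := by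
  simp only [symVec, nomVec, offOf, cond_false, add_zero, ← latPt_eq_apply_one]

/-- `symVec_false_true` (docstring added by the landing lane; see the module docstring). [formal bookkeeping] -/
theorem symVec_false_true (G : E3 →L[ℝ] E3) (ξ : E3) (n : Fin 3 → ℤ) : symVec false G ξ n true = latPt G hexFrame n + G (hcpShift + ξ) := by
  simp only [symVec, nomVec, offOf, cond_false, cond_true, shifted_eq_apply, add_assoc]

/-- Symbolic vectors are lattice vectors. [formal bookkeeping] -/
theorem symVec_mem (φ : Bool) (G : E3 →L[ℝ] E3) (ξ : E3) (n : Fin 3 → ℤ) (s : Bool) : symVec φ G ξ n s ∈ latSet φ G ξ := by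
  cases φ
  · cases s
    · exact ⟨n, Or.inl (symVec_false_false G ξ n)⟩
    · exact ⟨n, Or.inr (symVec_false_true G ξ n)⟩
  · exact ⟨n, symVec_true G ξ n s⟩

/-- … and every lattice vector is symbolic, with an ADMISSIBLE bit (fcc: `false`). [formal bookkeeping] -/
theorem exists_symVec_of_mem (hv : v ∈ latSet φ G ξ) : ∃ (n : Fin 3 → ℤ) (s : Bool), (φ = true → s = false) ∧ v = symVec φ G ξ n s := by
  cases φ
  · simp only [latSet, cond_false, Set.mem_setOf_eq] at hv
    obtain ⟨n, hn | hn⟩ := hv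
    · exact ⟨n, false, fun h => absurd h Bool.false_ne_true, by rw [hn, symVec_false_false]⟩
    · exact ⟨n, true, fun h => absurd h Bool.false_ne_true, by rw [hn, symVec_false_true]⟩
  · simp only [latSet, cond_true, Set.mem_setOf_eq] at hv
    obtain ⟨n, hn⟩ := hv
    exact ⟨n, false, fun _ => rfl, by rw [hn, symVec_true]⟩

/-- The centre: index `0`, bit `false` is the origin. [formal bookkeeping] -/
theorem symVec_zero_false (φ : Bool) (G : E3 →L[ℝ] E3) (ξ : E3) : symVec φ G ξ 0 false = 0 := by
  cases φ
  · rw [symVec_false_false, latPt_zero]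
  · rw [symVec_true, latPt_zero]

/-- `norm_offOf_le` (docstring added by the landing lane; see the module docstring). [formal bookkeeping] -/
theorem norm_offOf_le (φ s : Bool) (hξ : ‖ξ‖ ≤ 1 / 4) : ‖offOf φ s ξ‖ ≤ 1 / 4 := by
  cases φ <;> cases s <;> simp only [offOf, cond_true, cond_false, norm_zero] <;> first | exact hξ | norm_num

/-- ★ UPPER bound on an operator ball inside the quarter window: `‖symVec‖ ≤ ‖U₀ w‖ + r‖w‖ + 5/16` (`w` the nominal vector). [ELEMENTARY] -/
theorem norm_symVec_le (hG : ‖G - 1‖ ≤ 1 / 4) (hGU : ‖G - U₀‖ ≤ r) (hξ : ‖ξ‖ ≤ 1 / 4) (φ : Bool) (n : Fin 3 → ℤ) (s : Bool) :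
    ‖symVec φ G ξ n s‖ ≤ ‖U₀ (nomVec φ n s)‖ + r * ‖nomVec φ n s‖ + 5 / 16 := by
  have hsub : (G - U₀) (nomVec φ n s) = G (nomVec φ n s) - U₀ (nomVec φ n s) := by simp
  have hdec : symVec φ G ξ n s = U₀ (nomVec φ n s) + (G - U₀) (nomVec φ n s) + G (offOf φ s ξ) := by
    rw [symVec, map_add, hsub]; abel
  have h1 : ‖(G - U₀) (nomVec φ n s)‖ ≤ r * ‖nomVec φ n s‖ := ((G - U₀).le_opNorm _).trans (by gcongr)
  have h2 : ‖G (offOf φ s ξ)‖ ≤ 5 / 16 := by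
    have := norm_apply_le_of_near_one hG (offOf φ s ξ)
    have := norm_offOf_le φ s hξ
    nlinarith
  calc ‖symVec φ G ξ n s‖ = ‖U₀ (nomVec φ n s) + (G - U₀) (nomVec φ n s) + G (offOf φ s ξ)‖ := by rw [hdec]
    _ ≤ ‖U₀ (nomVec φ n s)‖ + ‖(G - U₀) (nomVec φ n s)‖ + ‖G (offOf φ s ξ)‖ := norm_add₃_le
    _ ≤ _ := by linarith

/-- ★ LOWER bound on the same ball: `‖U₀ w‖ − r‖w‖ − 5/16 ≤ ‖symVec‖`. [ELEMENTARY] -/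
theorem norm_symVec_ge (hG : ‖G - 1‖ ≤ 1 / 4) (hGU : ‖G - U₀‖ ≤ r) (hξ : ‖ξ‖ ≤ 1 / 4) (φ : Bool) (n : Fin 3 → ℤ) (s : Bool) :
    ‖U₀ (nomVec φ n s)‖ - r * ‖nomVec φ n s‖ - 5 / 16 ≤ ‖symVec φ G ξ n s‖ := by
  have hsub : (G - U₀) (nomVec φ n s) = G (nomVec φ n s) - U₀ (nomVec φ n s) := by simp
  have hdec : U₀ (nomVec φ n s) = symVec φ G ξ n s - (G - U₀) (nomVec φ n s) - G (offOf φ s ξ) := by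
    rw [symVec, map_add, hsub]; abel
  have h1 : ‖(G - U₀) (nomVec φ n s)‖ ≤ r * ‖nomVec φ n s‖ := ((G - U₀).le_opNorm _).trans (by gcongr)
  have h2 : ‖G (offOf φ s ξ)‖ ≤ 5 / 16 := by
    have := norm_apply_le_of_near_one hG (offOf φ s ξ)
    have := norm_offOf_le φ s hξ
    nlinarith
  have h3 : ‖U₀ (nomVec φ n s)‖ ≤ ‖symVec φ G ξ n s‖ + ‖(G - U₀) (nomVec φ n s)‖ + ‖G (offOf φ s ξ)‖ := by
    rw [hdec]; exact norm_sub_le_of_le (norm_sub_le _ _) le_rfl |>.trans (by linarith [norm_nonneg (G (offOf φ s ξ))])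
  linarith

/-- ★ INJECTIVITY ON INDEX DATA: inside the quarter window, distinct admissible `(n, s)` give distinct vectors. [tree: `latPt_fcc_injective`,
`latPt_hex_injective`, `shifted_ne_unshifted`] -/
theorem symVec_injective_idx (hG : ‖G - 1‖ ≤ 1 / 4) (hξ : ‖ξ‖ ≤ 1 / 4) (hs : φ = true → s = false) (hs' : φ = true → s' = false)
    (h : symVec φ G ξ n s = symVec φ G ξ n' s') : n = n' ∧ s = s' := by
  cases φ
  · cases s <;> cases s'
    · rw [symVec_false_false, symVec_false_false] at h
      exact ⟨latPt_hex_injective hG h, rfl⟩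
    · rw [symVec_false_false, symVec_false_true] at h
      exact absurd h.symm (shifted_ne_unshifted hG hξ n' n)
    · rw [symVec_false_true, symVec_false_false] at h
      exact absurd h (shifted_ne_unshifted hG hξ n n')
    · rw [symVec_false_true, symVec_false_true] at h
      exact ⟨latPt_hex_injective hG (add_right_cancel h), rfl⟩
  · rw [hs rfl, hs' rfl] at h ⊢
    rw [symVec_true, symVec_true] at h
    exact ⟨latPt_fcc_injective hG h, rfl⟩

/-- ★ FAR INDICES ARE AUTOMATIC for the completeness clause: `‖U₀ − 1‖ ≤ δ₀`, `165/16 < (1 − δ₀ − r)‖w‖ ⟹ 10 + 5/16 + r‖w‖ < ‖U₀ w‖` — so the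
unlisted-index check is FINITE (indices of nominal norm `≤ (165/16)/(1 − δ₀ − r)`). [ELEMENTARY] -/
theorem far_index_ok {δ₀ : ℝ} (hU₀ : ‖U₀ - 1‖ ≤ δ₀) {w : E3} (h : 165 / 16 < (1 - δ₀ - r) * ‖w‖) : 10 + 5 / 16 + r * ‖w‖ < ‖U₀ w‖ := by
  have hdec : w = U₀ w - (U₀ - 1) w := by simp
  have htri : ‖w‖ ≤ ‖U₀ w‖ + ‖(U₀ - 1) w‖ := by
    calc ‖w‖ = ‖U₀ w - (U₀ - 1) w‖ := by rw [← hdec]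
      _ ≤ ‖U₀ w‖ + ‖(U₀ - 1) w‖ := norm_sub_le _ _
  have hop : ‖(U₀ - 1) w‖ ≤ δ₀ * ‖w‖ := ((U₀ - 1).le_opNorm w).trans (by gcongr)
  nlinarith [norm_nonneg w]

end Sym

/-! ## §2. Index nets, operator-ball boxes, data-level goodness -/

/-- **An index net** (62B's `SymNet` without the nominal matrix): `K` references, each a finite list of (integer index, sublattice bit) on a branch,
with a centre label. -/
structure IdxNet (K : ℕ) where
  /-- branch of the `k`-th reference (`true` = fcc, `false` = hcp) -/
  φ : Fin K → Bool
  /-- number of sites of the `k`-th reference -/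
  M : Fin K → ℕ
  /-- integer lattice index of each site -/
  idx : (k : Fin K) → Fin (M k) → (Fin 3 → ℤ)
  /-- sublattice bit of each site (hcp B-site iff `true`) -/
  sub : (k : Fin K) → Fin (M k) → Bool
  /-- centre label -/
  c : (k : Fin K) → Fin (M k)

namespace IdxNet
variable {K : ℕ} (N : IdxNet K)

/-- Positions of reference `k` at parameters `(G, ξ)` — the abstract net's `R`. -/
def ref (k : Fin K) (G : E3 →L[ℝ] E3) (ξ : E3) : Fin (N.M k) → E3 := fun a => symVec (N.φ k) G ξ (N.idx k a) (N.sub k a)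

/-- Nominal vector of site `a` of reference `k`. -/
def nom (k : Fin K) (a : Fin (N.M k)) : E3 := nomVec (N.φ k) (N.idx k a) (N.sub k a)

/-- **`N.GoodData k U₀ r` [DATA-LEVEL · DECIDABLE on integer data + two real inequalities per index]** — bits admissible; index data pairwise distinct;
centre = `(0, false)`; listed nominal vectors satisfy `‖U₀ w‖ + r‖w‖ + 5/16 ≤ 14`; every admissible unlisted `(n, s)` satisfies
`10 + 5/16 + r‖w‖ < ‖U₀ w‖` (finitely many to check, `far_index_ok`). -/
def GoodData (k : Fin K) (U₀ : E3 →L[ℝ] E3) (r : ℝ) : Prop :=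
  0 ≤ r ∧ (N.φ k = true → ∀ a, N.sub k a = false) ∧ (∀ a a', N.idx k a = N.idx k a' → N.sub k a = N.sub k a' → a = a') ∧
    N.idx k (N.c k) = 0 ∧ N.sub k (N.c k) = false ∧ (∀ a, ‖U₀ (N.nom k a)‖ + r * ‖N.nom k a‖ + 5 / 16 ≤ 14) ∧
    ∀ (n : Fin 3 → ℤ) (s : Bool), (N.φ k = true → s = false) →
      (∃ a, N.idx k a = n ∧ N.sub k a = s) ∨ 10 + 5 / 16 + r * ‖nomVec (N.φ k) n s‖ < ‖U₀ (nomVec (N.φ k) n s)‖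

end IdxNet

/-- **Operator-ball boxes inside the quarter window** with offset cells `Ξ k`: `‖G − U₀ k‖ ≤ r k ∧ ‖G − 1‖ ≤ 1/4 ∧ ‖ξ‖ ≤ 1/4 ∧ ξ ∈ Ξ k`. -/
def ballBox {K : ℕ} (U₀ : Fin K → E3 →L[ℝ] E3) (r : Fin K → ℝ) (Ξ : Fin K → Set E3) : Fin K → (E3 →L[ℝ] E3) → E3 → Prop :=
  fun k G ξ => ‖G - U₀ k‖ ≤ r k ∧ ‖G - 1‖ ≤ 1 / 4 ∧ ‖ξ‖ ≤ 1 / 4 ∧ ξ ∈ Ξ k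

/-! ## §3. The five `NetGood` clauses (rev 3) from data-level goodness; the window cover from a ball cover -/

section Net
variable {K : ℕ} {N : IdxNet K} {U₀ : Fin K → E3 →L[ℝ] E3} {r : Fin K → ℝ} {Ξ : Fin K → Set E3}

/-- ★★ **`NetGood N.φ N.ref N.c (ballBox U₀ r Ξ)` (FrameCells rev 3, stated UNFOLDED) from `GoodData` on every box.** [PROVED junction] -/
theorem netGood_clauses_of_goodData (hgood : ∀ k, N.GoodData k (U₀ k) (r k)) :
    ∀ k G ξ, ballBox U₀ r Ξ k G ξ →
      Function.Injective (N.ref k G ξ) ∧ N.ref k G ξ (N.c k) = 0 ∧ (∀ a, ‖N.ref k G ξ a‖ ≤ 14) ∧ (∀ a, N.ref k G ξ a ∈ latSet (N.φ k) G ξ) ∧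
        ∀ v ∈ latSet (N.φ k) G ξ, ‖v‖ ≤ 10 → ∃ a, N.ref k G ξ a = v := by
  intro k G ξ hP
  obtain ⟨hGU, hG1, hξ, -⟩ := hP
  obtain ⟨hr, hbits, hdist, hc0, hcs, h14, hcompl⟩ := hgood k
  refine ⟨fun a a' h => ?_, ?_, fun a => ?_, fun a => symVec_mem _ _ _ _ _, fun v hv hv10 => ?_⟩
  · have hss := symVec_injective_idx hG1 hξ (fun hφ => hbits hφ a) (fun hφ => hbits hφ a') h
    exact hdist a a' hss.1 hss.2
  · show symVec (N.φ k) G ξ (N.idx k (N.c k)) (N.sub k (N.c k)) = 0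
    rw [hc0, hcs, symVec_zero_false]
  · exact (norm_symVec_le hG1 hGU hξ _ _ _).trans (h14 a)
  · obtain ⟨n, s, hs, rfl⟩ := exists_symVec_of_mem hv
    rcases hcompl n s hs with ⟨a, ha, has⟩ | hfar
    · exact ⟨a, by simp only [IdxNet.ref, ha, has]⟩
    · exfalso
      have hge := norm_symVec_ge hG1 hGU hξ (N.φ k) n s
      linarith

/-- **The window cover `BoxesCoverW N.φ (ballBox U₀ r Ξ) WSym` (stated UNFOLDED) from a cover of the symmetric quarter window by the balls and of the
offset ball by the cells.** [ELEMENTARY · finite-dimensional — the census's U-tree / ξ-leaf architecture supplies the hypothesis] -/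
theorem boxesCoverW_clauses_of_ballCover
    (hcov : ∀ (φ' : Bool) (U : E3 →L[ℝ] E3) (ξ : E3), SymOp U → PosOp U → ‖U - 1‖ ≤ 1 / 4 → ‖ξ‖ ≤ 1 / 4 →
      ∃ k, N.φ k = φ' ∧ ‖U - U₀ k‖ ≤ r k ∧ ξ ∈ Ξ k) :
    ∀ (φ' : Bool) (G : E3 →L[ℝ] E3) (ξ : E3), WSym φ' G ξ → ∃ k, N.φ k = φ' ∧ ballBox U₀ r Ξ k G ξ := by
  rintro φ' G ξ ⟨hsym, hpos, hG1, hξ⟩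
  obtain ⟨k, hk, hGU, hΞ⟩ := hcov φ' G ξ hsym hpos hG1 hξ
  exact ⟨k, hk, hGU, hG1, hξ, hΞ⟩

end Net

end Summit.AtomisticToContinuum.Crystallization.Theorems.FrustratedLawDichotomyStrainedPatchIndexNets
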